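import Literature.Probability.Percolation.LonelyClusterExchange
import HarnessLib

/-!
# `NoHeavyLowerTail` (stmt-CriticalPhenomena-4575) — hull-port line: the localized selection lemma LSL follows from the
# "mirror-worlds" marker inequality (SP)

Support file (prover `prim-hp-7`, hull-port prover #7; `--supports stmt-CriticalPhenomena-4575`); no definitions, no named facts, no
sorries; general finite vertex type `V`.  Pure bookkeeping (finite additivity + one three-line real inequality); NO correlation
inequality is used.

Setting (as in `HullPort.selection_pair_core`, `HullPort.threeCluster_marker` and `threeCluster_scenario_of_LSL` of the tree): relays `A`,
level `j`, `R_v = {|π(v)| ≤ j}` with `π(v)` the relays joined to `v`; observers `x₁, x₂`, `U = C(x₁) ∪ C(x₂)`; a guard vertex `z` and a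
marker `b`; `D_z = {z ↮ x₁} ∩ {z ↮ x₂}`, `D' = D_z ∩ {x₁ ↮ x₂}`;
`Ψ_b = [b ∈ U ∧ R_b] ∨ [b ∉ U ∧ |π(U)| ≤ j]` ("the `b`-selected piece of `U` is light").  The LOCALIZED SELECTION LEMMA (LSL, crux memo
run/shared/lean/prim/prim-hp-1/HULLPORT-COUPLING.md §15–§20; the hypothesis `hLSL` of `threeCluster_scenario_of_LSL`) is
`μ(D_z ∩ Ψ_b) ≤ max_i μ(D_z ∩ R_{x_i})`.  The "mirror worlds" are `G₋ = D' ∩ {|π(x₁)| ≤ j < |π(x₂)|}` (`x₁` light, `x₂` heavy) and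
`G₊ = D' ∩ {|π(x₂)| ≤ j < |π(x₁)|}`.

* `HullPort.lsl_core_of_sp` — if `x₁` is the `D_z`-better observer (`μ(D_z ∩ R_{x₂}) ≤ μ(D_z ∩ R_{x₁})`) and
  (SP) `μ(G₋ ∩ {b ↔ x₁}) · μ(G₊ ∩ {b ↔ x₂}) ≤ μ(G₋ ∩ {b ↮ x₁}) · μ(G₊ ∩ {b ↮ x₂})`
  ("the odds that the marker lies in the LIGHT cluster, multiplied over the two mirror worlds, is at most one"), then
  `μ(D_z ∩ Ψ_b) ≤ μ(D_z ∩ R_{x₁})`.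
* `HullPort.lsl_of_sp` — the `max` form (no domination hypothesis; (SP) is symmetric in `x₁, x₂`).
* `HullPort.le_of_add_le_of_mul_le` — the real inequality `A + B ≤ C + D`, `C·A ≤ D·B`, all `≥ 0` `⇒ A ≤ D`.

Why (SP) and not the exchange (LE) of the memo §16: the seat's census (run/shared/lean/prim/prim-hp-7/HP7-GX-FAMILY.md §2–2b) shows (LE) is FALSE
for a non-relay marker (exact 6-vertex witness), while (SP) — strictly weaker than (LE) and than the (refuted) balanced cell `(abs_b, lt)` —
has no violation in ≈ 5.5·10⁴ adversarial climbs and ≈ 3.1·10⁴ exact checks on the twisted-ladder family, for relay and non-relay markers and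
every level.  (SP) is therefore recorded as the single open inequality on the path LSL ⇒ (T⁻)_σ ⇒ (T⁻); it is NOT proved here.
[cite: VandenbergHaggstromKahn2005, Thm. 1.5 (p. 7) — context only; nothing of it is used in this file]
-/

noncomputable section

namespace Summit.CriticalPhenomena.PercolationContinuityZ3.Theorems

open MeasureTheory Set Literature.Probability.LatticeModels Literature.Probability.Percolation
open scoped Classical

variable {V : Type*}

namespace HullPort

/-- If `A + B ≤ C + D`, `C·A ≤ D·B` and all four are nonnegative then `A ≤ D`
(`A(A+B) ≤ A(C+D) ≤ DB + AD = D(A+B)`). [folklore] -/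
theorem le_of_add_le_of_mul_le {A B C D : ℝ} (hA : 0 ≤ A) (hB : 0 ≤ B) (hD : 0 ≤ D)
    (h1 : A + B ≤ C + D) (h2 : C * A ≤ D * B) : A ≤ D := by
  by_cases hAB : A + B = 0
  · have hA0 : A = 0 := by linarith
    rw [hA0]; exact hD
  · have hpos : 0 < A + B := lt_of_le_of_ne (by linarith) (Ne.symm hAB)
    have key : A * (A + B) ≤ D * (A + B) := by nlinarith
    exact le_of_mul_le_mul_right key hpos

/-- **LSL from (SP), core (the better observer is `x₁`).**  See the module docstring.  With
`D_z = {z ↮ x₁} ∩ {z ↮ x₂}`, `D' = D_z ∩ {x₁ ↮ x₂}`, `G₋ = D' ∩ {|π(x₁)| ≤ j < |π(x₂)|}`, `G₊ = D' ∩ {|π(x₂)| ≤ j < |π(x₁)|}`: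
if `μ(D_z ∩ R_{x₂}) ≤ μ(D_z ∩ R_{x₁})` and `μ(G₋, b ↔ x₁) μ(G₊, b ↔ x₂) ≤ μ(G₋, b ↮ x₁) μ(G₊, b ↮ x₂)` (SP), then
`μ(D_z ∩ Ψ_b) ≤ μ(D_z ∩ R_{x₁})`. [this file] -/
theorem lsl_core_of_sp [Fintype V] (w : Sym2 V → unitInterval) (A : Finset V) (x₁ x₂ z b : V) (j : ℕ)
    (hle : (prodBernoulli w).real {ω : BondConfig V | ¬ (openGraph ω).Reachable z x₁ ∧ ¬ (openGraph ω).Reachable z x₂ ∧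
        (A.filter fun q => ω ∈ openConn x₂ q).card ≤ j} ≤
      (prodBernoulli w).real {ω : BondConfig V | ¬ (openGraph ω).Reachable z x₁ ∧ ¬ (openGraph ω).Reachable z x₂ ∧
        (A.filter fun q => ω ∈ openConn x₁ q).card ≤ j})
    (hSP : (prodBernoulli w).real {ω : BondConfig V | (¬ (openGraph ω).Reachable z x₁ ∧ ¬ (openGraph ω).Reachable z x₂ ∧
          ¬ (openGraph ω).Reachable x₁ x₂) ∧ ((A.filter fun q => ω ∈ openConn x₁ q).card ≤ j ∧
          j < (A.filter fun q => ω ∈ openConn x₂ q).card) ∧ (openGraph ω).Reachable x₁ b} *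
        (prodBernoulli w).real {ω : BondConfig V | (¬ (openGraph ω).Reachable z x₁ ∧ ¬ (openGraph ω).Reachable z x₂ ∧
          ¬ (openGraph ω).Reachable x₁ x₂) ∧ ((A.filter fun q => ω ∈ openConn x₂ q).card ≤ j ∧
          j < (A.filter fun q => ω ∈ openConn x₁ q).card) ∧ (openGraph ω).Reachable x₂ b} ≤
      (prodBernoulli w).real {ω : BondConfig V | (¬ (openGraph ω).Reachable z x₁ ∧ ¬ (openGraph ω).Reachable z x₂ ∧
          ¬ (openGraph ω).Reachable x₁ x₂) ∧ ((A.filter fun q => ω ∈ openConn x₁ q).card ≤ j ∧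
          j < (A.filter fun q => ω ∈ openConn x₂ q).card) ∧ ¬ (openGraph ω).Reachable x₁ b} *
        (prodBernoulli w).real {ω : BondConfig V | (¬ (openGraph ω).Reachable z x₁ ∧ ¬ (openGraph ω).Reachable z x₂ ∧
          ¬ (openGraph ω).Reachable x₁ x₂) ∧ ((A.filter fun q => ω ∈ openConn x₂ q).card ≤ j ∧
          j < (A.filter fun q => ω ∈ openConn x₁ q).card) ∧ ¬ (openGraph ω).Reachable x₂ b}) :
    (prodBernoulli w).real ({ω : BondConfig V | ¬ (openGraph ω).Reachable z x₁ ∧ ¬ (openGraph ω).Reachable z x₂} ∩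
        {ω : BondConfig V | ((ω ∈ openConn x₁ b ∨ ω ∈ openConn x₂ b) ∧ (A.filter fun t => ω ∈ openConn b t).card ≤ j) ∨
          (ω ∉ openConn x₁ b ∧ ω ∉ openConn x₂ b ∧
            (A.filter fun t => ω ∈ openConn x₁ t ∨ ω ∈ openConn x₂ t).card ≤ j)}) ≤
      (prodBernoulli w).real {ω : BondConfig V | ¬ (openGraph ω).Reachable z x₁ ∧ ¬ (openGraph ω).Reachable z x₂ ∧
        (A.filter fun q => ω ∈ openConn x₁ q).card ≤ j} := by
  set μ := prodBernoulli w with hμ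
  have hmeas : ∀ S : Set (BondConfig V), MeasurableSet S := fun S => (Set.toFinite S).measurableSet
  -- names
  set Dz : Set (BondConfig V) := {ω | ¬ (openGraph ω).Reachable z x₁ ∧ ¬ (openGraph ω).Reachable z x₂} with hDz
  set D' : Set (BondConfig V) := {ω | ¬ (openGraph ω).Reachable z x₁ ∧ ¬ (openGraph ω).Reachable z x₂ ∧
      ¬ (openGraph ω).Reachable x₁ x₂} with hD'
  set R1 : Set (BondConfig V) := {ω | (A.filter fun q => ω ∈ openConn x₁ q).card ≤ j} with hR1
  set R2 : Set (BondConfig V) := {ω | (A.filter fun q => ω ∈ openConn x₂ q).card ≤ j} with hR2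
  set B1 : Set (BondConfig V) := {ω | (openGraph ω).Reachable x₁ b} with hB1
  set B2 : Set (BondConfig V) := {ω | (openGraph ω).Reachable x₂ b} with hB2
  set Ψ : Set (BondConfig V) := {ω : BondConfig V | ((ω ∈ openConn x₁ b ∨ ω ∈ openConn x₂ b) ∧
      (A.filter fun t => ω ∈ openConn b t).card ≤ j) ∨ (ω ∉ openConn x₁ b ∧ ω ∉ openConn x₂ b ∧
      (A.filter fun t => ω ∈ openConn x₁ t ∨ ω ∈ openConn x₂ t).card ≤ j)} with hΨ
  set Gm : Set (BondConfig V) := D' ∩ (R1 ∩ R2ᶜ) with hGm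
  set Gp : Set (BondConfig V) := D' ∩ (R2 ∩ R1ᶜ) with hGp
  -- rewrite the goal and the hypotheses in these names
  have eDzR1 : {ω : BondConfig V | ¬ (openGraph ω).Reachable z x₁ ∧ ¬ (openGraph ω).Reachable z x₂ ∧
      (A.filter fun q => ω ∈ openConn x₁ q).card ≤ j} = Dz ∩ R1 := by
    ext ω; simp only [hDz, hR1, mem_setOf_eq, mem_inter_iff]; tauto
  have eDzR2 : {ω : BondConfig V | ¬ (openGraph ω).Reachable z x₁ ∧ ¬ (openGraph ω).Reachable z x₂ ∧
      (A.filter fun q => ω ∈ openConn x₂ q).card ≤ j} = Dz ∩ R2 := by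
    ext ω; simp only [hDz, hR2, mem_setOf_eq, mem_inter_iff]; tauto
  have eGmB : {ω : BondConfig V | (¬ (openGraph ω).Reachable z x₁ ∧ ¬ (openGraph ω).Reachable z x₂ ∧
          ¬ (openGraph ω).Reachable x₁ x₂) ∧ ((A.filter fun q => ω ∈ openConn x₁ q).card ≤ j ∧
          j < (A.filter fun q => ω ∈ openConn x₂ q).card) ∧ (openGraph ω).Reachable x₁ b} = Gm ∩ B1 := by
    ext ω; simp only [hGm, hD', hR1, hR2, hB1, mem_setOf_eq, mem_inter_iff, mem_compl_iff, not_le]; tauto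
  have eGpB : {ω : BondConfig V | (¬ (openGraph ω).Reachable z x₁ ∧ ¬ (openGraph ω).Reachable z x₂ ∧
          ¬ (openGraph ω).Reachable x₁ x₂) ∧ ((A.filter fun q => ω ∈ openConn x₂ q).card ≤ j ∧
          j < (A.filter fun q => ω ∈ openConn x₁ q).card) ∧ (openGraph ω).Reachable x₂ b} = Gp ∩ B2 := by
    ext ω; simp only [hGp, hD', hR1, hR2, hB2, mem_setOf_eq, mem_inter_iff, mem_compl_iff, not_le]; tauto
  have eGmBc : {ω : BondConfig V | (¬ (openGraph ω).Reachable z x₁ ∧ ¬ (openGraph ω).Reachable z x₂ ∧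
          ¬ (openGraph ω).Reachable x₁ x₂) ∧ ((A.filter fun q => ω ∈ openConn x₁ q).card ≤ j ∧
          j < (A.filter fun q => ω ∈ openConn x₂ q).card) ∧ ¬ (openGraph ω).Reachable x₁ b} = Gm ∩ B1ᶜ := by
    ext ω; simp only [hGm, hD', hR1, hR2, hB1, mem_setOf_eq, mem_inter_iff, mem_compl_iff, not_le]; tauto
  have eGpBc : {ω : BondConfig V | (¬ (openGraph ω).Reachable z x₁ ∧ ¬ (openGraph ω).Reachable z x₂ ∧
          ¬ (openGraph ω).Reachable x₁ x₂) ∧ ((A.filter fun q => ω ∈ openConn x₂ q).card ≤ j ∧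
          j < (A.filter fun q => ω ∈ openConn x₁ q).card) ∧ ¬ (openGraph ω).Reachable x₂ b} = Gp ∩ B2ᶜ := by
    ext ω; simp only [hGp, hD', hR1, hR2, hB2, mem_setOf_eq, mem_inter_iff, mem_compl_iff, not_le]; tauto
  rw [eDzR1, eDzR2] at hle
  rw [eGmB, eGpB, eGmBc, eGpBc] at hSP
  rw [eDzR1]
  -- relay filters agree along a connection
  have filter_eq : ∀ (ω : BondConfig V) (u v : V), (openGraph ω).Reachable u v →
      (A.filter fun t => ω ∈ openConn v t) = (A.filter fun t => ω ∈ openConn u t) := by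
    intro ω u v huv
    exact Finset.filter_congr fun t _ =>
      ⟨fun ht => (huv.trans ht : (openGraph ω).Reachable u t),
        fun ht => (huv.symm.trans ht : (openGraph ω).Reachable v t)⟩
  have filter_union_eq : ∀ (ω : BondConfig V), (openGraph ω).Reachable x₁ x₂ →
      (A.filter fun t => ω ∈ openConn x₁ t ∨ ω ∈ openConn x₂ t) = (A.filter fun t => ω ∈ openConn x₁ t) := by
    intro ω h12
    exact Finset.filter_congr fun t _ =>
      ⟨fun ht => ht.elim id fun h2 => (h12.trans h2 : (openGraph ω).Reachable x₁ t), fun ht => Or.inl ht⟩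
  have filter_mono1 : ∀ (ω : BondConfig V),
      (A.filter fun t => ω ∈ openConn x₁ t).card ≤ (A.filter fun t => ω ∈ openConn x₁ t ∨ ω ∈ openConn x₂ t).card :=
    fun ω => Finset.card_le_card (fun t ht => by
      rw [Finset.mem_filter] at ht ⊢; exact ⟨ht.1, Or.inl ht.2⟩)
  have filter_mono2 : ∀ (ω : BondConfig V),
      (A.filter fun t => ω ∈ openConn x₂ t).card ≤ (A.filter fun t => ω ∈ openConn x₁ t ∨ ω ∈ openConn x₂ t).card :=
    fun ω => Finset.card_le_card (fun t ht => by
      rw [Finset.mem_filter] at ht ⊢; exact ⟨ht.1, Or.inr ht.2⟩)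
  -- the glued part S = Dz ∩ {x₁ ↔ x₂}: there Ψ = R1 = R2
  set S : Set (BondConfig V) := Dz ∩ {ω | (openGraph ω).Reachable x₁ x₂} with hS
  have hDzsplit : ∀ X : Set (BondConfig V), μ.real (Dz ∩ X) = μ.real (D' ∩ X) + μ.real (S ∩ X) := by
    intro X
    have hdisj : Disjoint (D' ∩ X) (S ∩ X) := by
      rw [Set.disjoint_left]
      rintro ω ⟨⟨-, -, h12⟩, -⟩ ⟨⟨-, h12'⟩, -⟩
      exact h12 h12'
    have hun : Dz ∩ X = (D' ∩ X) ∪ (S ∩ X) := by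
      ext ω
      simp only [hDz, hD', hS, mem_inter_iff, mem_setOf_eq, mem_union]
      constructor
      · rintro ⟨⟨h1, h2⟩, hX⟩
        by_cases h12 : (openGraph ω).Reachable x₁ x₂
        · exact Or.inr ⟨⟨⟨h1, h2⟩, h12⟩, hX⟩
        · exact Or.inl ⟨⟨h1, h2, h12⟩, hX⟩
      · rintro (⟨⟨h1, h2, -⟩, hX⟩ | ⟨⟨⟨h1, h2⟩, -⟩, hX⟩)
        · exact ⟨⟨h1, h2⟩, hX⟩
        · exact ⟨⟨h1, h2⟩, hX⟩
    rw [hun, measureReal_union hdisj (hmeas _)]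
  have hSΨ : S ∩ Ψ = S ∩ R1 := by
    ext ω
    simp only [hS, hΨ, hR1, hDz, mem_inter_iff, mem_setOf_eq]
    constructor
    · rintro ⟨⟨hz, h12⟩, hψ⟩
      refine ⟨⟨hz, h12⟩, ?_⟩
      rcases hψ with ⟨hbU, hRb⟩ | ⟨-, -, hU⟩
      · have hb1 : (openGraph ω).Reachable x₁ b := by
          rcases hbU with h | h
          · exact h
          · exact h12.trans h
        rw [filter_eq ω x₁ b hb1] at hRb; exact hRb
      · rw [filter_union_eq ω h12] at hU; exact hU
    · rintro ⟨⟨hz, h12⟩, hR⟩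
      refine ⟨⟨hz, h12⟩, ?_⟩
      by_cases hb1 : ω ∈ (openConn x₁ b : Set (BondConfig V))
      · have hb1' : (openGraph ω).Reachable x₁ b := hb1
        refine Or.inl ⟨Or.inl hb1, ?_⟩
        rw [filter_eq ω x₁ b hb1']; exact hR
      · have hb2 : ω ∉ (openConn x₂ b : Set (BondConfig V)) := by
          intro h
          have h' : (openGraph ω).Reachable x₂ b := h
          exact hb1 (h12.trans h')
        refine Or.inr ⟨hb1, hb2, ?_⟩
        rw [filter_union_eq ω h12]; exact hR
  have hSR : S ∩ R2 = S ∩ R1 := by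
    ext ω
    simp only [hS, hR1, hR2, hDz, mem_inter_iff, mem_setOf_eq]
    constructor
    · rintro ⟨⟨hz, h12⟩, hR⟩
      refine ⟨⟨hz, h12⟩, ?_⟩
      rw [filter_eq ω x₁ x₂ h12] at hR; exact hR
    · rintro ⟨⟨hz, h12⟩, hR⟩
      refine ⟨⟨hz, h12⟩, ?_⟩
      rw [filter_eq ω x₁ x₂ h12]; exact hR
  -- step 1: reduce to the separated part D'
  rw [hDzsplit Ψ, hDzsplit R1, hSΨ]
  suffices hmain : μ.real (D' ∩ Ψ) ≤ μ.real (D' ∩ R1) by linarith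
  -- step 2: D' ∩ Ψ ⊆ (D' ∩ Ψ ∩ R1) ∪ (Gp ∩ B2)
  have hΨsub : D' ∩ Ψ ⊆ (D' ∩ Ψ ∩ R1) ∪ (Gp ∩ B2) := by
    rintro ω ⟨hD, hψ⟩
    by_cases hR : ω ∈ R1
    · exact Or.inl ⟨⟨hD, hψ⟩, hR⟩
    · right
      have hR' : ¬ (A.filter fun q => ω ∈ openConn x₁ q).card ≤ j := hR
      simp only [hΨ, mem_setOf_eq] at hψ
      rcases hψ with ⟨hbU, hRb⟩ | ⟨-, -, hU⟩
      · rcases hbU with hb1 | hb2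
        · have hb1' : (openGraph ω).Reachable x₁ b := hb1
          rw [filter_eq ω x₁ b hb1'] at hRb; exact absurd hRb hR'
        · have hb2' : (openGraph ω).Reachable x₂ b := hb2
          rw [filter_eq ω x₂ b hb2'] at hRb
          refine ⟨⟨hD, ⟨hRb, hR⟩⟩, hb2'⟩
      · exact absurd ((filter_mono1 ω).trans hU) hR'
  -- step 3: (D' ∩ Ψ ∩ R1) and (Gm ∩ B1ᶜ) are disjoint subsets of D' ∩ R1
  have hsub3 : (D' ∩ Ψ ∩ R1) ∪ (Gm ∩ B1ᶜ) ⊆ D' ∩ R1 := by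
    rintro ω (⟨⟨hD, -⟩, hR⟩ | ⟨⟨hD, ⟨hR, -⟩⟩, -⟩)
    · exact ⟨hD, hR⟩
    · exact ⟨hD, hR⟩
  have hdisj3 : Disjoint (D' ∩ Ψ ∩ R1) (Gm ∩ B1ᶜ) := by
    rw [Set.disjoint_left]
    rintro ω ⟨⟨hD, hψ⟩, -⟩ ⟨⟨-, ⟨-, hR2c⟩⟩, hb1c⟩
    have hR2' : ¬ (A.filter fun q => ω ∈ openConn x₂ q).card ≤ j := hR2c
    have hb1' : ¬ (openGraph ω).Reachable x₁ b := hb1c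
    simp only [hΨ, mem_setOf_eq] at hψ
    rcases hψ with ⟨hbU, hRb⟩ | ⟨-, -, hU⟩
    · rcases hbU with hb1 | hb2
      · exact hb1' hb1
      · have hb2' : (openGraph ω).Reachable x₂ b := hb2
        rw [filter_eq ω x₂ b hb2'] at hRb; exact hR2' hRb
    · exact hR2' ((filter_mono2 ω).trans hU)
  -- step 4: so it suffices that μ(Gp ∩ B2) ≤ μ(Gm ∩ B1ᶜ)
  have hAD : μ.real (Gp ∩ B2) ≤ μ.real (Gm ∩ B1ᶜ) := by
    -- HYP on D': μ(D' ∩ R2) ≤ μ(D' ∩ R1), hence μ(Gp) ≤ μ(Gm)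
    have hle' : μ.real (D' ∩ R2) ≤ μ.real (D' ∩ R1) := by
      have h1 := hDzsplit R1
      have h2 := hDzsplit R2
      rw [hSR] at h2
      linarith
    have hsplitR2 : μ.real (D' ∩ R2) = μ.real (D' ∩ R2 ∩ R1) + μ.real Gp := by
      have h := measureReal_inter_add_sdiff (μ := μ) (s := D' ∩ R2) (hmeas R1)
      have e : (D' ∩ R2) \ R1 = Gp := by
        ext ω; simp only [hGp, mem_sdiff, mem_inter_iff, mem_compl_iff]; tauto
      rw [e] at h; linarith
    have hsplitR1 : μ.real (D' ∩ R1) = μ.real (D' ∩ R1 ∩ R2) + μ.real Gm := by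
      have h := measureReal_inter_add_sdiff (μ := μ) (s := D' ∩ R1) (hmeas R2)
      have e : (D' ∩ R1) \ R2 = Gm := by
        ext ω; simp only [hGm, mem_sdiff, mem_inter_iff, mem_compl_iff]; tauto
      rw [e] at h; linarith
    have hinter : D' ∩ R2 ∩ R1 = D' ∩ R1 ∩ R2 := by
      ext ω; simp only [mem_inter_iff]; tauto
    have hG : μ.real Gp ≤ μ.real Gm := by
      rw [hsplitR2, hsplitR1, hinter] at hle'; linarith
    have hGp2 : μ.real Gp = μ.real (Gp ∩ B2) + μ.real (Gp ∩ B2ᶜ) := by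
      have h := measureReal_inter_add_sdiff (μ := μ) (s := Gp) (hmeas B2)
      have e : Gp \ B2 = Gp ∩ B2ᶜ := by ext ω; simp only [mem_sdiff, mem_inter_iff, mem_compl_iff]
      rw [e] at h; linarith
    have hGm2 : μ.real Gm = μ.real (Gm ∩ B1) + μ.real (Gm ∩ B1ᶜ) := by
      have h := measureReal_inter_add_sdiff (μ := μ) (s := Gm) (hmeas B1)
      have e : Gm \ B1 = Gm ∩ B1ᶜ := by ext ω; simp only [mem_sdiff, mem_inter_iff, mem_compl_iff]
      rw [e] at h; linarith
    have h1 : μ.real (Gp ∩ B2) + μ.real (Gp ∩ B2ᶜ) ≤ μ.real (Gm ∩ B1) + μ.real (Gm ∩ B1ᶜ) := by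
      rw [← hGp2, ← hGm2]; exact hG
    exact le_of_add_le_of_mul_le measureReal_nonneg measureReal_nonneg measureReal_nonneg h1 hSP
  -- assemble
  calc μ.real (D' ∩ Ψ) ≤ μ.real ((D' ∩ Ψ ∩ R1) ∪ (Gp ∩ B2)) := measureReal_mono hΨsub (measure_ne_top _ _)
    _ ≤ μ.real (D' ∩ Ψ ∩ R1) + μ.real (Gp ∩ B2) := measureReal_union_le _ _
    _ ≤ μ.real (D' ∩ Ψ ∩ R1) + μ.real (Gm ∩ B1ᶜ) := by linarith
    _ = μ.real ((D' ∩ Ψ ∩ R1) ∪ (Gm ∩ B1ᶜ)) := (measureReal_union hdisj3 (hmeas _)).symm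
    _ ≤ μ.real (D' ∩ R1) := measureReal_mono hsub3 (measure_ne_top _ _)

/-- **LSL from (SP)** (`max` form, no domination hypothesis; this is exactly the hypothesis `hLSL` of
`threeCluster_scenario_of_LSL` for `Ψ = Ψ_b`).  (SP) is symmetric in the two observers, so one instance suffices.
[this file] -/
theorem lsl_of_sp [Fintype V] (w : Sym2 V → unitInterval) (A : Finset V) (x₁ x₂ z b : V) (j : ℕ)
    (hSP : (prodBernoulli w).real {ω : BondConfig V | (¬ (openGraph ω).Reachable z x₁ ∧ ¬ (openGraph ω).Reachable z x₂ ∧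
          ¬ (openGraph ω).Reachable x₁ x₂) ∧ ((A.filter fun q => ω ∈ openConn x₁ q).card ≤ j ∧
          j < (A.filter fun q => ω ∈ openConn x₂ q).card) ∧ (openGraph ω).Reachable x₁ b} *
        (prodBernoulli w).real {ω : BondConfig V | (¬ (openGraph ω).Reachable z x₁ ∧ ¬ (openGraph ω).Reachable z x₂ ∧
          ¬ (openGraph ω).Reachable x₁ x₂) ∧ ((A.filter fun q => ω ∈ openConn x₂ q).card ≤ j ∧
          j < (A.filter fun q => ω ∈ openConn x₁ q).card) ∧ (openGraph ω).Reachable x₂ b} ≤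
      (prodBernoulli w).real {ω : BondConfig V | (¬ (openGraph ω).Reachable z x₁ ∧ ¬ (openGraph ω).Reachable z x₂ ∧
          ¬ (openGraph ω).Reachable x₁ x₂) ∧ ((A.filter fun q => ω ∈ openConn x₁ q).card ≤ j ∧
          j < (A.filter fun q => ω ∈ openConn x₂ q).card) ∧ ¬ (openGraph ω).Reachable x₁ b} *
        (prodBernoulli w).real {ω : BondConfig V | (¬ (openGraph ω).Reachable z x₁ ∧ ¬ (openGraph ω).Reachable z x₂ ∧
          ¬ (openGraph ω).Reachable x₁ x₂) ∧ ((A.filter fun q => ω ∈ openConn x₂ q).card ≤ j ∧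
          j < (A.filter fun q => ω ∈ openConn x₁ q).card) ∧ ¬ (openGraph ω).Reachable x₂ b}) :
    (prodBernoulli w).real ({ω : BondConfig V | ¬ (openGraph ω).Reachable z x₁ ∧ ¬ (openGraph ω).Reachable z x₂} ∩
        {ω : BondConfig V | ((ω ∈ openConn x₁ b ∨ ω ∈ openConn x₂ b) ∧ (A.filter fun t => ω ∈ openConn b t).card ≤ j) ∨
          (ω ∉ openConn x₁ b ∧ ω ∉ openConn x₂ b ∧
            (A.filter fun t => ω ∈ openConn x₁ t ∨ ω ∈ openConn x₂ t).card ≤ j)}) ≤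
      max ((prodBernoulli w).real {ω : BondConfig V | ¬ (openGraph ω).Reachable z x₁ ∧ ¬ (openGraph ω).Reachable z x₂ ∧
              (A.filter fun q => ω ∈ openConn x₁ q).card ≤ j})
          ((prodBernoulli w).real {ω : BondConfig V | ¬ (openGraph ω).Reachable z x₁ ∧ ¬ (openGraph ω).Reachable z x₂ ∧
              (A.filter fun q => ω ∈ openConn x₂ q).card ≤ j}) := by
  by_cases hle : (prodBernoulli w).real {ω : BondConfig V | ¬ (openGraph ω).Reachable z x₁ ∧ ¬ (openGraph ω).Reachable z x₂ ∧
        (A.filter fun q => ω ∈ openConn x₂ q).card ≤ j} ≤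
      (prodBernoulli w).real {ω : BondConfig V | ¬ (openGraph ω).Reachable z x₁ ∧ ¬ (openGraph ω).Reachable z x₂ ∧
        (A.filter fun q => ω ∈ openConn x₁ q).card ≤ j}
  · exact (lsl_core_of_sp w A x₁ x₂ z b j hle hSP).trans (le_max_left _ _)
  · have hle' := (lt_of_not_ge hle).le
    -- swap the observers: all sets are invariant, (SP) has its two factors exchanged
    have eDz : ∀ (P : BondConfig V → Prop), {ω : BondConfig V | ¬ (openGraph ω).Reachable z x₂ ∧
        ¬ (openGraph ω).Reachable z x₁ ∧ P ω} = {ω : BondConfig V | ¬ (openGraph ω).Reachable z x₁ ∧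
        ¬ (openGraph ω).Reachable z x₂ ∧ P ω} := by
      intro P; ext ω; simp only [mem_setOf_eq]; tauto
    have eD' : ∀ (P : BondConfig V → Prop), {ω : BondConfig V | (¬ (openGraph ω).Reachable z x₂ ∧
        ¬ (openGraph ω).Reachable z x₁ ∧ ¬ (openGraph ω).Reachable x₂ x₁) ∧ P ω} =
        {ω : BondConfig V | (¬ (openGraph ω).Reachable z x₁ ∧ ¬ (openGraph ω).Reachable z x₂ ∧
        ¬ (openGraph ω).Reachable x₁ x₂) ∧ P ω} := by
      intro P; ext ω; simp only [mem_setOf_eq]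
      constructor
      · rintro ⟨⟨h2, h1, h21⟩, hP⟩; exact ⟨⟨h1, h2, fun h => h21 h.symm⟩, hP⟩
      · rintro ⟨⟨h1, h2, h12⟩, hP⟩; exact ⟨⟨h2, h1, fun h => h12 h.symm⟩, hP⟩
    have eΨ : ({ω : BondConfig V | ¬ (openGraph ω).Reachable z x₂ ∧ ¬ (openGraph ω).Reachable z x₁} ∩
        {ω : BondConfig V | ((ω ∈ openConn x₂ b ∨ ω ∈ openConn x₁ b) ∧ (A.filter fun t => ω ∈ openConn b t).card ≤ j) ∨
          (ω ∉ openConn x₂ b ∧ ω ∉ openConn x₁ b ∧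
            (A.filter fun t => ω ∈ openConn x₂ t ∨ ω ∈ openConn x₁ t).card ≤ j)}) =
        ({ω : BondConfig V | ¬ (openGraph ω).Reachable z x₁ ∧ ¬ (openGraph ω).Reachable z x₂} ∩
        {ω : BondConfig V | ((ω ∈ openConn x₁ b ∨ ω ∈ openConn x₂ b) ∧ (A.filter fun t => ω ∈ openConn b t).card ≤ j) ∨
          (ω ∉ openConn x₁ b ∧ ω ∉ openConn x₂ b ∧
            (A.filter fun t => ω ∈ openConn x₁ t ∨ ω ∈ openConn x₂ t).card ≤ j)}) := by
      have hfilt : ∀ ω : BondConfig V, (A.filter fun t => ω ∈ openConn x₂ t ∨ ω ∈ openConn x₁ t) =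
          (A.filter fun t => ω ∈ openConn x₁ t ∨ ω ∈ openConn x₂ t) :=
        fun ω => Finset.filter_congr fun t _ => or_comm
      ext ω; simp only [mem_inter_iff, mem_setOf_eq, hfilt ω]; tauto
    have core := lsl_core_of_sp w A x₂ x₁ z b j
    rw [eDz, eDz, eD', eD', eD', eD', eΨ] at core
    have h := core hle' (by rw [mul_comm]; nth_rewrite 2 [mul_comm]; exact hSP)
    exact h.trans (le_max_right _ _)

end HullPort

end Summit.CriticalPhenomena.PercolationContinuityZ3.Theorems
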